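import Summits.NavierStokesRegularity.FunctionalMining.HsConvectionTrilinear
import Summits.NavierStokesRegularity.FunctionalMining.HsProductionBoundOne
import HarnessLib

/-!
# FunctionalMining — rows `EF.s=3/4, 5/4, 3/2 | T_LD | G1` and `EK.EF.s=3/2 | T_M0` are theorems

Search for candidate a priori estimates; no regularity claim. Cell `pub-nsfunc`, prove seat
(gen 12). The typed located gap `HsProductionBound s C` of `HsSaturatingLawReduction`
(`|N_s(v)| ≤ C (2ℰ)^{(2s−1)/(4s)} E_s^{1/2} E_{s+1}^{(2s+1)/(4s)}` on smooth divergence-free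
zero-mean fields of `T³`) is PROVED at `s = 3/4`, `s = 5/4`, `s = 3/2` from the trilinear bound
`N_s² ≤ C₀ E_{t₁+1} E_{t₂} E_{t₃+2s}` (`sq_hsInertialRate_le_trilinear`, `HsConvectionTrilinear`) with

* `s = 3/4`: `(t₁,t₂,t₃) = (1/2, 5/4, −1/4)`, then `E_{3/2} ≤ E_1^{1/3}E_{7/4}^{2/3}`,
  `E_{5/4} ≤ E_1^{2/3}E_{7/4}^{1/3}`, `E_1 ≤ E_{3/4}^{3/4}E_{7/4}^{1/4}`;
* `s = 5/4`: `(3/4, 5/4, −1/2)`, then `E_{7/4} ≤ E_{5/4}^{1/2}E_{9/4}^{1/2}`, `E_2 ≤ E_{5/4}^{1/4}E_{9/4}^{3/4}`,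
  `E_{5/4} ≤ E_1^{4/5}E_{9/4}^{1/5}`;
* `s = 3/2`: `(1, 5/4, −3/4)`, then `E_2 ≤ E_{3/2}^{1/2}E_{5/2}^{1/2}`, `E_{5/4} ≤ E_1^{1/2}E_{3/2}^{1/2}`,
  `E_{9/4} ≤ E_{3/2}^{1/4}E_{5/2}^{3/4}`, `E_{3/2} ≤ E_1^{2/3}E_{5/2}^{1/3}`

(log-convexity `torusHsEnergy_interpolation`; `2ℰ = E_1`). Consequently the K0 rows are UNCONDITIONAL
tree theorems: `∃ κ, SaturatingLaw (torusHsEnergy (3/4)) (1/2) 5 κ`,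
`∃ κ, SaturatingLaw (torusHsEnergy (5/4)) (3/2) (7/3) κ`, `∃ κ, SaturatingLaw (torusHsEnergy (3/2)) 2 2 κ`
(via `hsEnergy_saturatingLaw_*_of_bound`), and the Lyapunov mirror `EK.EF.s=3/2 | T_M0`
(`hsEnergy_lyapunov_three_halves_of_bound`). A priori differential inequalities along smooth
solutions (small-data closing only); no regularity claim.
-/

noncomputable section

open MeasureTheory Set Filter Topology Function Real
open scoped InnerProductSpace RealInnerProductSpace

namespace Summit.NavierStokesRegularity.FunctionalMining

open Literature.Analysis Literature.Analysis.FunctionSpaces Literature.Analysis.FluidPDE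
open Literature.Analysis.FunctionSpaces.Torus Literature.Analysis.FluidPDE.Torus

/-! ## 1. Bookkeeping helpers -/

/-- From `N² ≤ C₀ · X^{2x} S Z^{2z}` to `|N| ≤ √C₀ · X^x S^{1/2} Z^z` (nonnegative `C₀, X, S, Z`).
[folklore] -/
theorem abs_le_of_sq_le_rpow_mul {N C₀ X S Z x z : ℝ} (hC₀ : 0 ≤ C₀) (hX : 0 ≤ X) (hS : 0 ≤ S)
    (hZ : 0 ≤ Z) (h : N ^ 2 ≤ C₀ * (X ^ (2 * x) * S * Z ^ (2 * z))) :
    |N| ≤ Real.sqrt C₀ * X ^ x * S ^ (1 / 2 : ℝ) * Z ^ z := by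
  have hR : 0 ≤ Real.sqrt C₀ * X ^ x * S ^ (1 / 2 : ℝ) * Z ^ z := by positivity
  have hsq : (Real.sqrt C₀ * X ^ x * S ^ (1 / 2 : ℝ) * Z ^ z) ^ 2 = C₀ * (X ^ (2 * x) * S * Z ^ (2 * z)) := by
    rw [mul_pow, mul_pow, mul_pow, Real.sq_sqrt hC₀, ← Real.rpow_natCast (X ^ x), ← Real.rpow_mul hX,
      ← Real.rpow_natCast (S ^ (1 / 2 : ℝ)), ← Real.rpow_mul hS, ← Real.rpow_natCast (Z ^ z),
      ← Real.rpow_mul hZ]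
    norm_num
    ring_nf
  calc |N| = Real.sqrt (N ^ 2) := (Real.sqrt_sq_eq_abs N).symm
    _ ≤ Real.sqrt ((Real.sqrt C₀ * X ^ x * S ^ (1 / 2 : ℝ) * Z ^ z) ^ 2) :=
        Real.sqrt_le_sqrt (h.trans_eq hsq.symm)
    _ = _ := Real.sqrt_sq hR

/-- `2ℰ(v) = E_1(v)` for smooth `v`. [folklore] -/
theorem two_mul_torusEnstrophy_eq {d : Type*} [Fintype d] [DecidableEq d]
    {v : UnitAddTorus d → EuclideanSpace ℝ d} (hv : IsSmooth v) :
    2 * torusEnstrophy v = torusHsEnergy 1 v := by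
  rw [torusHsEnergy_one hv, gradNormSq_eq_two_mul_torusEnstrophy]

/-- The interpolation inequality with the order and the exponents precomputed. [folklore] -/
theorem torusHsEnergy_interp {d : Type*} [Fintype d] [DecidableEq d] {s₀ s₁ θ s α : ℝ}
    (hs₀ : 0 ≤ s₀) (hs₁ : 0 ≤ s₁) (hθ0 : 0 < θ) (hθ1 : θ < 1) (hs : (1 - θ) * s₀ + θ * s₁ = s)
    (hα : 1 - θ = α) {v : UnitAddTorus d → EuclideanSpace ℝ d} (hv : IsSmooth v) :
    torusHsEnergy s v ≤ torusHsEnergy s₀ v ^ α * torusHsEnergy s₁ v ^ θ := by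
  rw [← hs, ← hα]; exact torusHsEnergy_interpolation hs₀ hs₁ hθ0 hθ1 hv

/-! ## 2. `s = 3/4` -/

/-- **`HsProductionBound (3/4) C` holds for some `C ≥ 0`** (trilinear bound at
`(t₁,t₂,t₃) = (1/2, 5/4, −1/4)`: `N² ≲ E_{3/2}E_{5/4}²`, then interpolation). [ours] -/
theorem exists_hsProductionBound_three_quarters : ∃ C : ℝ, 0 ≤ C ∧ HsProductionBound (3 / 4) C := by
  obtain ⟨C₀, hC₀, h⟩ := sq_hsInertialRate_le_trilinear (d := Fin 3) (by simp) (t₁ := 1 / 2) (t₂ := 5 / 4)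
    (t₃ := -1 / 4) (by norm_num) (by norm_num) (by norm_num) (by norm_num) (s := 3 / 4) (by norm_num)
    (by norm_num) (by norm_num) (by norm_num)
  refine ⟨Real.sqrt C₀, Real.sqrt_nonneg _, fun v hv _ hmean => ?_⟩
  have hN := h v hv hmean
  rw [show (1 / 2 : ℝ) + 1 = 3 / 2 by norm_num, show (-1 / 4 : ℝ) + 2 * (3 / 4) = 5 / 4 by norm_num] at hN
  rw [show (2 * (3 / 4 : ℝ) - 1) / (4 * (3 / 4)) = 1 / 6 by norm_num,
    show (2 * (3 / 4 : ℝ) + 1) / (4 * (3 / 4)) = 5 / 6 by norm_num, show (3 / 4 : ℝ) + 1 = 7 / 4 by norm_num,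
    two_mul_torusEnstrophy_eq hv]
  set X := torusHsEnergy 1 v with hX
  set S := torusHsEnergy (3 / 4) v with hS
  set Z := torusHsEnergy (7 / 4) v with hZ
  set U := torusHsEnergy (3 / 2) v with hU
  set V := torusHsEnergy (5 / 4) v with hV
  have hX0 : 0 ≤ X := torusHsEnergy_nonneg (by norm_num) hv
  have hS0 : 0 ≤ S := torusHsEnergy_nonneg (by norm_num) hv
  have hZ0 : 0 ≤ Z := torusHsEnergy_nonneg (by norm_num) hv
  have hV0 : 0 ≤ V := torusHsEnergy_nonneg (by norm_num) hv
  have iU : U ≤ X ^ (1 / 3 : ℝ) * Z ^ (2 / 3 : ℝ) :=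
    torusHsEnergy_interp (s₀ := 1) (s₁ := 7 / 4) (θ := 2 / 3) (by norm_num) (by norm_num) (by norm_num)
      (by norm_num) (by norm_num) (by norm_num) hv
  have iV : V ≤ X ^ (2 / 3 : ℝ) * Z ^ (1 / 3 : ℝ) :=
    torusHsEnergy_interp (s₀ := 1) (s₁ := 7 / 4) (θ := 1 / 3) (by norm_num) (by norm_num) (by norm_num)
      (by norm_num) (by norm_num) (by norm_num) hv
  have iX : X ≤ S ^ (3 / 4 : ℝ) * Z ^ (1 / 4 : ℝ) :=
    torusHsEnergy_interp (s₀ := 3 / 4) (s₁ := 7 / 4) (θ := 1 / 4) (by norm_num) (by norm_num) (by norm_num)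
      (by norm_num) (by norm_num) (by norm_num) hv
  -- the monomial inequality
  have key : U * V * V ≤ X ^ (2 * (1 / 6 : ℝ)) * S * Z ^ (2 * (5 / 6 : ℝ)) := by
    have e1 : X ^ (1 / 3 : ℝ) * Z ^ (2 / 3 : ℝ) * (X ^ (2 / 3 : ℝ) * Z ^ (1 / 3 : ℝ)) * (X ^ (2 / 3 : ℝ) * Z ^ (1 / 3 : ℝ)) =
        X ^ (1 / 3 : ℝ) * X ^ (4 / 3 : ℝ) * Z ^ (4 / 3 : ℝ) := by
      have ex : X ^ (2 / 3 : ℝ) * X ^ (2 / 3 : ℝ) = X ^ (4 / 3 : ℝ) := by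
        rw [← Real.rpow_add' hX0 (by norm_num)]; norm_num
      have ez : Z ^ (2 / 3 : ℝ) * Z ^ (1 / 3 : ℝ) * Z ^ (1 / 3 : ℝ) = Z ^ (4 / 3 : ℝ) := by
        rw [← Real.rpow_add' hZ0 (by norm_num), ← Real.rpow_add' hZ0 (by norm_num)]; norm_num
      calc _ = X ^ (1 / 3 : ℝ) * (X ^ (2 / 3 : ℝ) * X ^ (2 / 3 : ℝ)) *
            (Z ^ (2 / 3 : ℝ) * Z ^ (1 / 3 : ℝ) * Z ^ (1 / 3 : ℝ)) := by ring
        _ = _ := by rw [ex, ez]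
    have e2 : (S ^ (3 / 4 : ℝ) * Z ^ (1 / 4 : ℝ)) ^ (4 / 3 : ℝ) = S * Z ^ (1 / 3 : ℝ) := by
      rw [Real.mul_rpow (Real.rpow_nonneg hS0 _) (Real.rpow_nonneg hZ0 _), ← Real.rpow_mul hS0,
        ← Real.rpow_mul hZ0]
      norm_num
    have hX43 : X ^ (4 / 3 : ℝ) ≤ S * Z ^ (1 / 3 : ℝ) := by
      rw [← e2]; exact Real.rpow_le_rpow hX0 iX (by norm_num)
    calc U * V * V ≤ X ^ (1 / 3 : ℝ) * Z ^ (2 / 3 : ℝ) * (X ^ (2 / 3 : ℝ) * Z ^ (1 / 3 : ℝ)) *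
          (X ^ (2 / 3 : ℝ) * Z ^ (1 / 3 : ℝ)) :=
          mul_le_mul (mul_le_mul iU iV hV0 (by positivity)) iV hV0 (by positivity)
      _ = X ^ (1 / 3 : ℝ) * X ^ (4 / 3 : ℝ) * Z ^ (4 / 3 : ℝ) := e1
      _ ≤ X ^ (1 / 3 : ℝ) * (S * Z ^ (1 / 3 : ℝ)) * Z ^ (4 / 3 : ℝ) :=
          mul_le_mul_of_nonneg_right (mul_le_mul_of_nonneg_left hX43 (Real.rpow_nonneg hX0 _))
            (Real.rpow_nonneg hZ0 _)
      _ = X ^ (2 * (1 / 6 : ℝ)) * S * Z ^ (2 * (5 / 6 : ℝ)) := by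
          rw [show (2 : ℝ) * (1 / 6) = 1 / 3 by norm_num, show (2 : ℝ) * (5 / 6) = 1 / 3 + 4 / 3 by norm_num,
            Real.rpow_add' hZ0 (by norm_num)]
          ring
  exact abs_le_of_sq_le_rpow_mul hC₀ hX0 hS0 hZ0 ((hN.trans (mul_le_mul_of_nonneg_left key hC₀)))

/-! ## 3. `s = 5/4` -/

/-- **`HsProductionBound (5/4) C` holds for some `C ≥ 0`** (trilinear bound at
`(t₁,t₂,t₃) = (3/4, 5/4, −1/2)`: `N² ≲ E_{7/4}E_{5/4}E_2`, then interpolation). [ours] -/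
theorem exists_hsProductionBound_five_quarters : ∃ C : ℝ, 0 ≤ C ∧ HsProductionBound (5 / 4) C := by
  obtain ⟨C₀, hC₀, h⟩ := sq_hsInertialRate_le_trilinear (d := Fin 3) (by simp) (t₁ := 3 / 4) (t₂ := 5 / 4)
    (t₃ := -1 / 2) (by norm_num) (by norm_num) (by norm_num) (by norm_num) (s := 5 / 4) (by norm_num)
    (by norm_num) (by norm_num) (by norm_num)
  refine ⟨Real.sqrt C₀, Real.sqrt_nonneg _, fun v hv _ hmean => ?_⟩
  have hN := h v hv hmean
  rw [show (3 / 4 : ℝ) + 1 = 7 / 4 by norm_num, show (-1 / 2 : ℝ) + 2 * (5 / 4) = 2 by norm_num] at hN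
  rw [show (2 * (5 / 4 : ℝ) - 1) / (4 * (5 / 4)) = 3 / 10 by norm_num,
    show (2 * (5 / 4 : ℝ) + 1) / (4 * (5 / 4)) = 7 / 10 by norm_num, show (5 / 4 : ℝ) + 1 = 9 / 4 by norm_num,
    two_mul_torusEnstrophy_eq hv]
  set X := torusHsEnergy 1 v with hX
  set S := torusHsEnergy (5 / 4) v with hS
  set Z := torusHsEnergy (9 / 4) v with hZ
  set U := torusHsEnergy (7 / 4) v with hU
  set W := torusHsEnergy 2 v with hW
  have hX0 : 0 ≤ X := torusHsEnergy_nonneg (by norm_num) hv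
  have hS0 : 0 ≤ S := torusHsEnergy_nonneg (by norm_num) hv
  have hZ0 : 0 ≤ Z := torusHsEnergy_nonneg (by norm_num) hv
  have hW0 : 0 ≤ W := torusHsEnergy_nonneg (by norm_num) hv
  have iU : U ≤ S ^ (1 / 2 : ℝ) * Z ^ (1 / 2 : ℝ) :=
    torusHsEnergy_interp (s₀ := 5 / 4) (s₁ := 9 / 4) (θ := 1 / 2) (by norm_num) (by norm_num) (by norm_num)
      (by norm_num) (by norm_num) (by norm_num) hv
  have iW : W ≤ S ^ (1 / 4 : ℝ) * Z ^ (3 / 4 : ℝ) :=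
    torusHsEnergy_interp (s₀ := 5 / 4) (s₁ := 9 / 4) (θ := 3 / 4) (by norm_num) (by norm_num) (by norm_num)
      (by norm_num) (by norm_num) (by norm_num) hv
  have iS : S ≤ X ^ (4 / 5 : ℝ) * Z ^ (1 / 5 : ℝ) :=
    torusHsEnergy_interp (s₀ := 1) (s₁ := 9 / 4) (θ := 1 / 5) (by norm_num) (by norm_num) (by norm_num)
      (by norm_num) (by norm_num) (by norm_num) hv
  have key : U * S * W ≤ X ^ (2 * (3 / 10 : ℝ)) * S * Z ^ (2 * (7 / 10 : ℝ)) := by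
    -- `U S W ≤ S^{1/2}Z^{1/2} · S · S^{1/4}Z^{3/4} = S · S^{3/4} · Z^{5/4}` and `S^{3/4} ≤ X^{3/5} Z^{3/20}`
    have e1 : S ^ (1 / 2 : ℝ) * Z ^ (1 / 2 : ℝ) * S * (S ^ (1 / 4 : ℝ) * Z ^ (3 / 4 : ℝ)) =
        S * S ^ (3 / 4 : ℝ) * Z ^ (5 / 4 : ℝ) := by
      have es : S ^ (1 / 2 : ℝ) * S ^ (1 / 4 : ℝ) = S ^ (3 / 4 : ℝ) := by
        rw [← Real.rpow_add' hS0 (by norm_num)]; norm_num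
      have ez : Z ^ (1 / 2 : ℝ) * Z ^ (3 / 4 : ℝ) = Z ^ (5 / 4 : ℝ) := by
        rw [← Real.rpow_add' hZ0 (by norm_num)]; norm_num
      calc _ = S * (S ^ (1 / 2 : ℝ) * S ^ (1 / 4 : ℝ)) * (Z ^ (1 / 2 : ℝ) * Z ^ (3 / 4 : ℝ)) := by ring
        _ = _ := by rw [es, ez]
    have e2 : (X ^ (4 / 5 : ℝ) * Z ^ (1 / 5 : ℝ)) ^ (3 / 4 : ℝ) = X ^ (3 / 5 : ℝ) * Z ^ (3 / 20 : ℝ) := by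
      rw [Real.mul_rpow (Real.rpow_nonneg hX0 _) (Real.rpow_nonneg hZ0 _), ← Real.rpow_mul hX0,
        ← Real.rpow_mul hZ0]
      norm_num
    have hS34 : S ^ (3 / 4 : ℝ) ≤ X ^ (3 / 5 : ℝ) * Z ^ (3 / 20 : ℝ) := by
      rw [← e2]; exact Real.rpow_le_rpow hS0 iS (by norm_num)
    calc U * S * W ≤ S ^ (1 / 2 : ℝ) * Z ^ (1 / 2 : ℝ) * S * (S ^ (1 / 4 : ℝ) * Z ^ (3 / 4 : ℝ)) :=
          mul_le_mul (mul_le_mul_of_nonneg_right iU hS0) iW hW0 (by positivity)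
      _ = S * S ^ (3 / 4 : ℝ) * Z ^ (5 / 4 : ℝ) := e1
      _ ≤ S * (X ^ (3 / 5 : ℝ) * Z ^ (3 / 20 : ℝ)) * Z ^ (5 / 4 : ℝ) :=
          mul_le_mul_of_nonneg_right (mul_le_mul_of_nonneg_left hS34 hS0) (Real.rpow_nonneg hZ0 _)
      _ = X ^ (2 * (3 / 10 : ℝ)) * S * Z ^ (2 * (7 / 10 : ℝ)) := by
          rw [show (2 : ℝ) * (3 / 10) = 3 / 5 by norm_num, show (2 : ℝ) * (7 / 10) = 3 / 20 + 5 / 4 by norm_num,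
            Real.rpow_add' hZ0 (by norm_num)]
          ring
  exact abs_le_of_sq_le_rpow_mul hC₀ hX0 hS0 hZ0 ((hN.trans (mul_le_mul_of_nonneg_left key hC₀)))

/-! ## 4. `s = 3/2` -/

/-- **`HsProductionBound (3/2) C` holds for some `C ≥ 0`** (trilinear bound at
`(t₁,t₂,t₃) = (1, 5/4, −3/4)`: `N² ≲ E_2 E_{5/4} E_{9/4}`, then interpolation). [ours] -/
theorem exists_hsProductionBound_three_halves : ∃ C : ℝ, 0 ≤ C ∧ HsProductionBound (3 / 2) C := by
  obtain ⟨C₀, hC₀, h⟩ := sq_hsInertialRate_le_trilinear (d := Fin 3) (by simp) (t₁ := 1) (t₂ := 5 / 4)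
    (t₃ := -3 / 4) (by norm_num) (by norm_num) (by norm_num) (by norm_num) (s := 3 / 2) (by norm_num)
    (by norm_num) (by norm_num) (by norm_num)
  refine ⟨Real.sqrt C₀, Real.sqrt_nonneg _, fun v hv _ hmean => ?_⟩
  have hN := h v hv hmean
  rw [show (1 : ℝ) + 1 = 2 by norm_num, show (-3 / 4 : ℝ) + 2 * (3 / 2) = 9 / 4 by norm_num] at hN
  rw [show (2 * (3 / 2 : ℝ) - 1) / (4 * (3 / 2)) = 1 / 3 by norm_num,
    show (2 * (3 / 2 : ℝ) + 1) / (4 * (3 / 2)) = 2 / 3 by norm_num, show (3 / 2 : ℝ) + 1 = 5 / 2 by norm_num,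
    two_mul_torusEnstrophy_eq hv]
  set X := torusHsEnergy 1 v with hX
  set S := torusHsEnergy (3 / 2) v with hS
  set Z := torusHsEnergy (5 / 2) v with hZ
  set U := torusHsEnergy 2 v with hU
  set V := torusHsEnergy (5 / 4) v with hV
  set W := torusHsEnergy (9 / 4) v with hW
  have hX0 : 0 ≤ X := torusHsEnergy_nonneg (by norm_num) hv
  have hS0 : 0 ≤ S := torusHsEnergy_nonneg (by norm_num) hv
  have hZ0 : 0 ≤ Z := torusHsEnergy_nonneg (by norm_num) hv
  have hV0 : 0 ≤ V := torusHsEnergy_nonneg (by norm_num) hv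
  have hW0 : 0 ≤ W := torusHsEnergy_nonneg (by norm_num) hv
  have iU : U ≤ S ^ (1 / 2 : ℝ) * Z ^ (1 / 2 : ℝ) :=
    torusHsEnergy_interp (s₀ := 3 / 2) (s₁ := 5 / 2) (θ := 1 / 2) (by norm_num) (by norm_num) (by norm_num)
      (by norm_num) (by norm_num) (by norm_num) hv
  have iV : V ≤ X ^ (1 / 2 : ℝ) * S ^ (1 / 2 : ℝ) :=
    torusHsEnergy_interp (s₀ := 1) (s₁ := 3 / 2) (θ := 1 / 2) (by norm_num) (by norm_num) (by norm_num)
      (by norm_num) (by norm_num) (by norm_num) hv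
  have iW : W ≤ S ^ (1 / 4 : ℝ) * Z ^ (3 / 4 : ℝ) :=
    torusHsEnergy_interp (s₀ := 3 / 2) (s₁ := 5 / 2) (θ := 3 / 4) (by norm_num) (by norm_num) (by norm_num)
      (by norm_num) (by norm_num) (by norm_num) hv
  have iS : S ≤ X ^ (2 / 3 : ℝ) * Z ^ (1 / 3 : ℝ) :=
    torusHsEnergy_interp (s₀ := 1) (s₁ := 5 / 2) (θ := 1 / 3) (by norm_num) (by norm_num) (by norm_num)
      (by norm_num) (by norm_num) (by norm_num) hv
  have key : U * V * W ≤ X ^ (2 * (1 / 3 : ℝ)) * S * Z ^ (2 * (2 / 3 : ℝ)) := by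
    -- `U V W ≤ X^{1/2} S^{5/4} Z^{5/4} = X^{1/2} · S · S^{1/4} · Z^{5/4}` and `S^{1/4} ≤ X^{1/6} Z^{1/12}`
    have e1 : S ^ (1 / 2 : ℝ) * Z ^ (1 / 2 : ℝ) * (X ^ (1 / 2 : ℝ) * S ^ (1 / 2 : ℝ)) *
        (S ^ (1 / 4 : ℝ) * Z ^ (3 / 4 : ℝ)) = X ^ (1 / 2 : ℝ) * (S * S ^ (1 / 4 : ℝ)) * Z ^ (5 / 4 : ℝ) := by
      have es : S ^ (1 / 2 : ℝ) * S ^ (1 / 2 : ℝ) = S := by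
        rw [← Real.rpow_add' hS0 (by norm_num)]; norm_num
      have ez : Z ^ (1 / 2 : ℝ) * Z ^ (3 / 4 : ℝ) = Z ^ (5 / 4 : ℝ) := by
        rw [← Real.rpow_add' hZ0 (by norm_num)]; norm_num
      calc _ = X ^ (1 / 2 : ℝ) * (S ^ (1 / 2 : ℝ) * S ^ (1 / 2 : ℝ) * S ^ (1 / 4 : ℝ)) *
            (Z ^ (1 / 2 : ℝ) * Z ^ (3 / 4 : ℝ)) := by ring
        _ = _ := by rw [es, ez]
    have e2 : (X ^ (2 / 3 : ℝ) * Z ^ (1 / 3 : ℝ)) ^ (1 / 4 : ℝ) = X ^ (1 / 6 : ℝ) * Z ^ (1 / 12 : ℝ) := by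
      rw [Real.mul_rpow (Real.rpow_nonneg hX0 _) (Real.rpow_nonneg hZ0 _), ← Real.rpow_mul hX0,
        ← Real.rpow_mul hZ0]
      norm_num
    have hS14 : S ^ (1 / 4 : ℝ) ≤ X ^ (1 / 6 : ℝ) * Z ^ (1 / 12 : ℝ) := by
      rw [← e2]; exact Real.rpow_le_rpow hS0 iS (by norm_num)
    calc U * V * W ≤ S ^ (1 / 2 : ℝ) * Z ^ (1 / 2 : ℝ) * (X ^ (1 / 2 : ℝ) * S ^ (1 / 2 : ℝ)) *
          (S ^ (1 / 4 : ℝ) * Z ^ (3 / 4 : ℝ)) :=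
          mul_le_mul (mul_le_mul iU iV hV0 (by positivity)) iW hW0 (by positivity)
      _ = X ^ (1 / 2 : ℝ) * (S * S ^ (1 / 4 : ℝ)) * Z ^ (5 / 4 : ℝ) := e1
      _ ≤ X ^ (1 / 2 : ℝ) * (S * (X ^ (1 / 6 : ℝ) * Z ^ (1 / 12 : ℝ))) * Z ^ (5 / 4 : ℝ) :=
          mul_le_mul_of_nonneg_right (mul_le_mul_of_nonneg_left (mul_le_mul_of_nonneg_left hS14 hS0)
            (Real.rpow_nonneg hX0 _)) (Real.rpow_nonneg hZ0 _)
      _ = X ^ (2 * (1 / 3 : ℝ)) * S * Z ^ (2 * (2 / 3 : ℝ)) := by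
          rw [show (2 : ℝ) * (1 / 3) = 1 / 2 + 1 / 6 by norm_num, show (2 : ℝ) * (2 / 3) = 1 / 12 + 5 / 4 by norm_num,
            Real.rpow_add' hX0 (by norm_num), Real.rpow_add' hZ0 (by norm_num)]
          ring
  exact abs_le_of_sq_le_rpow_mul hC₀ hX0 hS0 hZ0 ((hN.trans (mul_le_mul_of_nonneg_left key hC₀)))

/-! ## 5. The rows -/

/-- **K0 row `EF.s=3/4 | T_LD | G1` is a theorem**: `∃ κ, dE_{3/4}/dt ≤ κ ν⁻⁵ (2ℰ) E_{3/4}³` along every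
zero-mean classical solution on `T³` (`SaturatingLaw (torusHsEnergy (3/4)) (1/2) 5 κ`). [ours] -/
theorem hsEnergy_saturatingLaw_three_quarters :
    ∃ κ : ℝ, SaturatingLaw (d := Fin 3) (torusHsEnergy (3 / 4)) (1 / 2) 5 κ := by
  obtain ⟨C, hC, h⟩ := exists_hsProductionBound_three_quarters
  exact hsEnergy_saturatingLaw_three_quarters_of_bound hC h

/-- **K0 row `EF.s=5/4 | T_LD | G1` is a theorem**: `∃ κ, dE_{5/4}/dt ≤ κ ν^{−7/3} (2ℰ) E_{5/4}^{5/3}`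
(`SaturatingLaw (torusHsEnergy (5/4)) (3/2) (7/3) κ`). [ours] -/
theorem hsEnergy_saturatingLaw_five_quarters :
    ∃ κ : ℝ, SaturatingLaw (d := Fin 3) (torusHsEnergy (5 / 4)) (3 / 2) (7 / 3) κ := by
  obtain ⟨C, hC, h⟩ := exists_hsProductionBound_five_quarters
  exact hsEnergy_saturatingLaw_five_quarters_of_bound hC h

/-- **K0 row `EF.s=3/2 | T_LD | G1` is a theorem**: `∃ κ, dE_{3/2}/dt ≤ κ ν⁻² (2ℰ) E_{3/2}^{3/2}`
(`SaturatingLaw (torusHsEnergy (3/2)) 2 2 κ`). [ours] -/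
theorem hsEnergy_saturatingLaw_three_halves :
    ∃ κ : ℝ, SaturatingLaw (d := Fin 3) (torusHsEnergy (3 / 2)) 2 2 κ := by
  obtain ⟨C, hC, h⟩ := exists_hsProductionBound_three_halves
  exact hsEnergy_saturatingLaw_three_halves_of_bound hC h

/-- **K0 row `EK.EF.s=3/2 | T_M0` is a theorem**: there is `κ > 0` such that
`K − (2/κ) ν³ E_{3/2}^{−1/2}` is non-increasing on every positive-`E_{3/2}` window of a zero-mean
classical solution on `T³`. [ours] -/
theorem hsEnergy_lyapunov_three_halves :
    ∃ κ : ℝ, 0 < κ ∧ ∀ {ν a b : ℝ}, 0 < ν → a < b →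
      ∀ {u : ℝ → UnitAddTorus (Fin 3) → EuclideanSpace ℝ (Fin 3)} {p : ℝ → UnitAddTorus (Fin 3) → ℝ},
        Torus.IsClassicalNSSolutionOn (Icc a b) ν 0 u p →
        (∀ t ∈ Icc a b, Torus.HasZeroMean (u t)) →
        (∀ t ∈ Icc a b, 0 < torusHsEnergy (3 / 2) (u t)) →
        AntitoneOn (fun t => Torus.kineticEnergy (u t) -
            2 / κ * ν ^ ((2 : ℝ) + 1) * torusHsEnergy (3 / 2) (u t) ^ (-(2 : ℝ)⁻¹)) (Icc a b) := by
  obtain ⟨C, _, h⟩ := exists_hsProductionBound_three_halves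
  exact hsEnergy_lyapunov_three_halves_of_bound h

end Summit.NavierStokesRegularity.FunctionalMining
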